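import Literature.NumberTheory.Automorphic.ArtinCompletedLFunctionEntire
import Literature.NumberTheory.Automorphic.BookerStrongArtin
import Literature.NumberTheory.Automorphic.BookerKrishnamurthyConverseRatProofs
import Literature.NumberTheory.GaloisRepresentations.FramedRepDualIrreducible
import HarnessLib

/-!
# Booker 2003 from Booker–Krishnamurthy 2011: the library reduction of
# `booker_strongArtin_of_artinConjecture` (proofs only)

Companion of `Automorphic/BookerStrongArtin` (the named fact
`booker_strongArtin_of_artinConjecture`: A. R. Booker, *Poles of Artin L-functions and the strong
Artin conjecture*, Ann. of Math. 158 (2003), Corollary p. 1090, "the Artin conjecture for `ρ`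
implies the strong Artin conjecture for `ρ`", `ρ : Gal(ℚ̄/ℚ) → GL₂(ℂ)` irreducible), of
`Automorphic/BookerKrishnamurthyConverseRatProofs` (the `F = ℚ` instance of the named fact
`bookerKrishnamurthy_isPiOfArtinRep_of_entire_twists`, Booker–Krishnamurthy, Compositio Math.
147 (2011), Cor. 1.2 — op. cit. p. 670: "whenever `L(s, ρ)` is holomorphic, as predicted by
Artin's conjecture, there is a modular form `f` (of either holomorphic or Maass type) such that
`L(s, ρ) = L(s, f)`", recovering [Boo03]) and of `Automorphic/ArtinCompletedLFunctionEntire`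
(`L(s, ρ)` entire ⇒ `γ(ρ, s) L(s, ρ)` entire, given Artin's functional equation and
`(ρ^∨)^{Γ_K} = 0`).

Booker's printed proof of the Corollary is his Theorem (a pole of a Dirichlet twist forces
infinitely many poles of `L(s, ρ)`; pp. 1091–1097) combined with "the `GL(2)` converse theorem
[20]" (Weil 1967); Booker–Krishnamurthy's Cor. 1.2 packages exactly this combination ("Our
approach is based on that of [Boo03], where it was shown that twists can be eliminated altogether
in the converse theorem for two-dimensional complex Galois representations `ρ` over `ℚ`", p. 670).
This file PROVES the remaining glue, so that the 2003 fact reduces to the 2011 fact, Artin's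
functional equation and a cuspidality criterion:

* `invariants_eq_bot_of_isIrreducible_of_one_lt_finrank`, `invariants_toArtinRep_dual_eq_bot` —
  an irreducible representation of dimension `≥ 2` has no invariants; applied to `σ^∨`
  (`FramedRep.isIrreducible_toContinuousRep_dual`), this is the hypothesis `(σ^∨)^{Γ_K} = 0` of
  the analytic lemma.
* `hasEntireContinuation_gammaFactor_mul_artinLFunction_of_isIrreducible` — for irreducible
  `σ : Γ_K → GL_n(ℂ)`, `n ≥ 2`, satisfying Artin's functional equation against `σ^∨`:
  `L(s, σ)` entire ⇒ `γ(σ, s) L(σ, s)` entire (the exact hypothesis of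
  `bookerKrishnamurthy_isPiOfArtinRep_of_entire_twists.rat`).
* `booker_isPiOfArtinRep_of_artinConjecture_of_bookerKrishnamurthy` (**proved reduction**):
  granting the named facts `bookerKrishnamurthy_isPiOfArtinRep_of_entire_twists` (BK 2011,
  Cor. 1.2) and `artin_functional_equation` over `ℚ` (Neukirch VII (12.6)), every irreducible
  `σ : Γ_ℚ → GL₂(ℂ)` with `L(s, σ)` entire is automorphic in the almost-everywhere sense
  `IsPiOfArtinRep σ π` for some automorphic representation `π` of `GL₂(𝔸_ℚ)` — Booker's
  Corollary with "automorphic" not asserted cuspidal (BK 2011, Remark (i), p. 670: "`π` need not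
  be cuspidal, since we allow poles. The cuspidality criterion is Theorem 10.10 of Jacquet and
  Langlands [JL70]").
* `booker_strongArtin_of_artinConjecture_of_bookerKrishnamurthy` (**proved reduction of the
  named fact**): the same two facts together with the cuspidality upgrade for irreducible `σ` —
  written out in full as the hypothesis `hcusp` (D-0026: NOT vendored as a named fact here; in
  print it is Jacquet–Langlands 1970, Thm. 10.10 with §12: an automorphic representation of
  `GL₂` matching an IRREDUCIBLE Galois representation at almost all places is cuspidal, a
  non-cuspidal one being a constituent of a global principal series `π(μ₁, μ₂)` with Satake
  parameters `{μ₁(ϖ_v), μ₂(ϖ_v)}`) — imply `booker_strongArtin_of_artinConjecture` verbatim.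

So `booker_strongArtin_of_artinConjecture_holds` is this file's last theorem applied to
`bookerKrishnamurthy_isPiOfArtinRep_of_entire_twists_holds`, `artin_functional_equation_holds`
and a proof of the cuspidality criterion, none of which is in the tree yet (the first is the
`GL(2)` converse theorem with Booker's pole analysis; the second is reduced in
`Automorphic/ArtinLFunctionsFunctionalEquation` to two undischarged leaves).  In the
solvable-image cases the fact's conclusion also follows from `strongArtin_of_isSolvable`
(`booker_conclusion_of_isSolvable`, `Automorphic/BookerStrongArtinSanity`), so the content is the
icosahedral case, as Booker says (p. 1090).  No definition and no named fact is introduced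
(D-0026); theorems only.

## References

* A. R. Booker, *Poles of Artin L-functions and the strong Artin conjecture*, Ann. of Math. (2)
  158 (2003), 1089–1098: Theorem and Corollary (p. 1090), p. 1091. [Booker2003]
* A. R. Booker, M. Krishnamurthy, *A strengthening of the GL(2) converse theorem*, Compositio
  Math. 147 (2011), 669–715: Thm. 1.1, Cor. 1.2, Remark (i) (p. 670), p. 671.
  [BookerKrishnamurthy2011]
* H. Jacquet, R. P. Langlands, *Automorphic Forms on GL(2)*, LNM 114 (1970), Thm. 10.10, §12.
  [JacquetLanglands1970]
* J. Neukirch, *Algebraic Number Theory* (1999), VII §12, Thm. (12.6). [NeukirchANT1999]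
* J.-P. Serre, *Linear Representations of Finite Groups* (1977), §1.4 (d), §2.3.
  [SerreLinearRepresentations1977]

## Mathlib / tree search

`lean search` for `booker_isPiOfArtinRep`, `booker_strongArtin_of_artinConjecture_of`,
`invariants_eq_bot_of_isIrreducible`,
`hasEntireContinuation_gammaFactor_mul_artinLFunction_of_isIrreducible`: nothing before this
file.  Mathlib: `Representation.IsIrreducible` (`IsSimpleOrder (Subrepresentation ρ)`),
`finrank_span_singleton`; no automorphic representations, converse theorems or Artin
`L`-functions.
-/

noncomputable section

open scoped MatrixGroups NumberField Topology Classical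
open Field IsDedekindDomain Module NumberField Filter Complex Set
open Literature.NumberTheory.GaloisRepresentations

namespace Literature.NumberTheory.Automorphic

/-! ### An irreducible representation of dimension `≥ 2` has no invariants -/

section Invariants

/-- **An irreducible representation of dimension at least `2` has no non-zero invariant vector**
(Serre, *Linear Representations of Finite Groups*, §2.3: `dim V^G = ⟨χ, 1⟩ = 0` for a
non-trivial irreducible `χ`).  Elementary proof over any field, for Mathlib's
`Representation.IsIrreducible` (= the lattice of subrepresentations is simple): the invariants
form a subrepresentation, hence are `0` or everything; in the latter case `G` acts trivially,
every line is a subrepresentation, and a line is neither `0` nor everything when `dim V ≥ 2`.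
[cite: SerreLinearRepresentations1977, §2.3] -/
theorem invariants_eq_bot_of_isIrreducible_of_one_lt_finrank
    {k G V : Type*} [Field k] [Group G] [AddCommGroup V] [Module k V]
    (ρ : Representation k G V) (hirr : ρ.IsIrreducible) (hV : 1 < finrank k V) :
    ρ.invariants = ⊥ := by
  let I : Subrepresentation ρ := ⟨ρ.invariants, fun g v hv => by
    rw [Representation.mem_invariants] at hv ⊢
    intro h
    rw [hv g, hv h]⟩
  haveI := hirr
  rcases IsSimpleOrder.eq_bot_or_eq_top I with h | h
  · exact congrArg Subrepresentation.toSubmodule h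
  · exfalso
    have hall : ∀ (g : G) (v : V), ρ g v = v := fun g v => by
      have hv : v ∈ I.toSubmodule := by
        rw [h]
        exact Submodule.mem_top
      exact (Representation.mem_invariants ρ v).mp hv g
    have hpos : 0 < finrank k V := zero_lt_one.trans hV
    haveI : Nontrivial V := Module.nontrivial_of_finrank_pos hpos
    obtain ⟨v, hv⟩ := exists_ne (0 : V)
    let L : Subrepresentation ρ := ⟨k ∙ v, fun g w hw => by rw [hall g w]; exact hw⟩
    rcases IsSimpleOrder.eq_bot_or_eq_top L with hL | hL
    · have hbot : (k ∙ v : Submodule k V) = ⊥ := congrArg Subrepresentation.toSubmodule hL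
      exact hv (Submodule.span_singleton_eq_bot.mp hbot)
    · have htop : (k ∙ v : Submodule k V) = ⊤ := congrArg Subrepresentation.toSubmodule hL
      have h1 : finrank k (k ∙ v : Submodule k V) = 1 := finrank_span_singleton hv
      rw [htop, finrank_top] at h1
      omega

/-- **The contragredient of an irreducible `σ : Γ_K → GL_n(ℂ)`, `n ≥ 2`, has no invariants**:
`σ^∨` (`FramedRep.dual`, inverse transpose) is irreducible with `σ`
(`FramedRep.isIrreducible_toContinuousRep_dual`, Serre §1.4 (d)), so
`invariants_eq_bot_of_isIrreducible_of_one_lt_finrank` applies to the representation on `ℂⁿ`.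
This is the hypothesis `(ρ^∨)^{Γ_K} = 0` under which `L(s, ρ^∨)` is regular and non-zero at
`s = 1` (`artinLFunction_tendsto_ne_zero_of_invariants_eq_bot`).
[cite: SerreLinearRepresentations1977, §1.4 (d) and §2.3] -/
theorem invariants_toArtinRep_dual_eq_bot {K : Type} [Field K] {n : ℕ}
    (σ : FramedArtinRep K n) (hirr : σ.toGaloisRep.IsIrreducible) (hn : 1 < n) :
    (FramedArtinRep.toArtinRep (FramedRep.dual σ)).invariants = ⊥ :=
  invariants_eq_bot_of_isIrreducible_of_one_lt_finrank _
    (FramedRep.isIrreducible_toContinuousRep_dual σ hirr) (by simpa using hn)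

end Invariants

/-! ### The `γ · L` form for irreducible `σ` -/

section Irreducible

variable {K : Type} [Field K] [NumberField K]

/-- **`L(s, σ)` entire ⇒ `Λ₀(s) = γ(σ, s) L(σ, s)` entire, for irreducible `σ` of dimension
`≥ 2` satisfying Artin's functional equation** — the exact hypothesis of
`bookerKrishnamurthy_isPiOfArtinRep_of_entire_twists.rat`: if `σ : Γ_K → GL_n(ℂ)`, `n ≥ 2`, is
irreducible, satisfies Artin's functional equation against `σ^∨`
(`ArtinRep.SatisfiesFunctionalEquation`, the clause of `artin_functional_equation`), and
`L(s, σ)` is entire, then `γ(σ, s) L(σ, s)` is entire: `(σ^∨)^{Γ_K} = 0` by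
`invariants_toArtinRep_dual_eq_bot`, so
`hasEntireContinuation_gammaFactor_mul_artinLFunction_of_hasEntireContinuation` applies
(Booker 2003, p. 1091: holomorphy of `L(s, ρ)` in `Re s ≥ 1` and, by the functional equation,
in `Re s ≤ 0`). [cite: Booker2003, p. 1091] [cite: NeukirchANT1999, VII §12, Thm. (12.6)] -/
theorem hasEntireContinuation_gammaFactor_mul_artinLFunction_of_isIrreducible {n : ℕ}
    (σ : FramedArtinRep K n) (hn : 1 < n) (hirr : σ.toGaloisRep.IsIrreducible)
    (hFE : σ.toArtinRep.SatisfiesFunctionalEquation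
      (FramedArtinRep.toArtinRep (FramedRep.dual σ)))
    (hL : LFunction.HasEntireContinuation (artinLFunction σ.toArtinRep)) :
    LFunction.HasEntireContinuation
      fun s => σ.toArtinRep.gammaFactor s * artinLFunction σ.toArtinRep s :=
  hasEntireContinuation_gammaFactor_mul_artinLFunction_of_hasEntireContinuation σ hFE
    (invariants_toArtinRep_dual_eq_bot σ hirr hn) hL

end Irreducible

/-! ### Booker's Corollary from Booker–Krishnamurthy, Artin's FE and cuspidality -/

section Booker

/-- **Booker 2003, Corollary (automorphic form), from Booker–Krishnamurthy 2011 and Artin's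
functional equation** — proved reduction.  Granting the named facts
`bookerKrishnamurthy_isPiOfArtinRep_of_entire_twists` (Compositio 147 (2011), Cor. 1.2; p. 670:
"whenever `L(s, ρ)` is holomorphic, as predicted by Artin's conjecture, there is a modular form
`f` … such that `L(s, ρ) = L(s, f)`", "[Boo03]") and `artin_functional_equation` over `ℚ`
(Neukirch VII (12.6)): for every irreducible continuous `σ : Γ_ℚ → GL₂(ℂ)` whose Artin
`L`-function `L(s, σ)` (`artinLFunction`) has an entire continuation, there is an automorphic
representation `π` of `GL₂(𝔸_ℚ)` (Borel–Jacquet datum, not asserted cuspidal — BK 2011,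
Remark (i)) with `π = π(σ)` in Tunnell's almost-everywhere sense `IsPiOfArtinRep σ π`.  Proof:
`L` entire ⇒ `γ · L` entire
(`hasEntireContinuation_gammaFactor_mul_artinLFunction_of_isIrreducible`) ⇒ the `F = ℚ`
instance `bookerKrishnamurthy_isPiOfArtinRep_of_entire_twists.rat` (over `ℚ` the
everywhere-unramified unitary twists are the `‖·‖^{it}`, BK 2011, p. 671).
[cite: Booker2003, Corollary (p. 1090)]
[cite: BookerKrishnamurthy2011, Cor. 1.2 and Remark (i) (p. 670), p. 671] -/
theorem booker_isPiOfArtinRep_of_artinConjecture_of_bookerKrishnamurthy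
    (hBK : bookerKrishnamurthy_isPiOfArtinRep_of_entire_twists)
    (hFE : artin_functional_equation (K := ℚ)) (σ : FramedArtinRep ℚ 2)
    (hirr : σ.toGaloisRep.IsIrreducible)
    (hL : LFunction.HasEntireContinuation (artinLFunction σ.toArtinRep)) :
    ∃ (hcpt : isCompact_glFiniteIntegralLevel 2 ℚ)
      (π : AutomorphicRepData (AutomorphyDatum.gl 2 ℚ hcpt)), IsPiOfArtinRep σ π :=
  hBK.rat σ (hasEntireContinuation_gammaFactor_mul_artinLFunction_of_isIrreducible σ one_lt_two
    hirr (hFE σ) hL)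

/-- **`booker_strongArtin_of_artinConjecture` from Booker–Krishnamurthy 2011, Artin's functional
equation and the cuspidality criterion** — proved reduction of the named fact of
`Automorphic/BookerStrongArtin` (Booker 2003, Corollary p. 1090: "the Artin conjecture for `ρ`
implies the strong Artin conjecture for `ρ`", `π` cuspidal).  Hypotheses: the named facts
`bookerKrishnamurthy_isPiOfArtinRep_of_entire_twists` (BK 2011, Cor. 1.2) and
`artin_functional_equation` over `ℚ` (Neukirch VII (12.6)), and — written out in full, NOT
vendored as a named fact (D-0026) — the cuspidality upgrade `hcusp`: an automorphic
representation `π` of `GL₂(𝔸_ℚ)` with `π = π(σ)` almost everywhere for an IRREDUCIBLE `σ` may be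
replaced by a cuspidal one with the same property (BK 2011, Remark (i), p. 670: "The cuspidality
criterion is Theorem 10.10 of Jacquet and Langlands [JL70]"; equivalently, a non-cuspidal
automorphic representation of `GL₂` is a constituent of a global principal series `π(μ₁, μ₂)`,
whose Satake parameters `{μ₁(ϖ_v), μ₂(ϖ_v)}` cannot match an irreducible `σ` at almost all
places, Jacquet–Langlands 1970, §10 and §12).  Conclusion: `booker_strongArtin_of_artinConjecture`
verbatim (its conclusion is the definiens of `IsPiOfArtinRep σ π₀.1`,
`booker_strongArtin_of_artinConjecture_iff`).  The fact's discharge is this theorem applied to the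
two `_holds` theorems and a proof of `hcusp`, none yet in the tree.
[cite: Booker2003, Corollary (p. 1090)]
[cite: BookerKrishnamurthy2011, Cor. 1.2 and Remark (i) (p. 670)]
[cite: JacquetLanglands1970, Thm. 10.10 and §12] -/
theorem booker_strongArtin_of_artinConjecture_of_bookerKrishnamurthy
    (hBK : bookerKrishnamurthy_isPiOfArtinRep_of_entire_twists)
    (hFE : artin_functional_equation (K := ℚ))
    (hcusp : ∀ (hcpt : isCompact_glFiniteIntegralLevel 2 ℚ) (σ : FramedArtinRep ℚ 2)
      (π : AutomorphicRepData (AutomorphyDatum.gl 2 ℚ hcpt)),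
      σ.toGaloisRep.IsIrreducible → IsPiOfArtinRep σ π →
        ∃ π₀ : CuspidalAutomorphicRepData 2 ℚ hcpt, IsPiOfArtinRep σ π₀.1) :
    booker_strongArtin_of_artinConjecture := by
  intro σ hirr hL
  obtain ⟨hcpt, π, hπ⟩ :=
    booker_isPiOfArtinRep_of_artinConjecture_of_bookerKrishnamurthy hBK hFE σ hirr hL
  obtain ⟨π₀, hπ₀⟩ := hcusp hcpt σ π hirr hπ
  exact ⟨hcpt, π₀, hπ₀⟩

end Booker

end Literature.NumberTheory.Automorphic

end
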